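import Mathlib
import Literature.Analysis.FluidPDE.TypeIAncientMild
import Literature.Analysis.FluidPDE.OseenSlice
import HarnessLib

/-!
# Route SymmetryModuliCount — crux `HelicalEndLiouville` (stmt-NavierStokesRegularity-14062),
# line `vanishing-cell-reynolds`, stub 5: far-past cell extinction by absorption

Registered stub `stub_cellAbsorption` of the skeleton `Cruxes/HelicalEndLiouville/Lines/
vanishing-cell-reynolds.lean`: given the heat cell gap (stub 2 (i), constant `κ`), the Duhamel
representation of the cell oscillation `w = u − Π₀u`, `Π₀f(x) = ∫₀¹ f(x + rL) dr` (stub 3) and the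
linear slice bound (stub 4, constant `K`), an `L`-periodic element `u ∈ A_C`
(`IsTypeIAncientMild C u`) on an end `t < θ ≤ 0` satisfies `u(t, x + sL) = u(t, x)` for all `s`
at every `t < θ` with `t < −(8KC‖L‖)²` (vanishing cell Reynolds number `C‖L‖/√(−t)`).
Proof: on the end `τ ≤ t` the slices are bounded by `M₀ = C/√(−t)`, the oscillation by `2M₀`;
a uniform bound `B` of the oscillation improves to `B/2` (free term
`≤ |κ|‖L‖²C/((τ−s)√(−s)) → 0` as `s → −∞`; Duhamel term `≤ K⁺M₀B · ∫₀^{τ−s} min(σ^{-1/2},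
‖L‖²σ^{-3/2}) dσ ≤ 4K⁺‖L‖M₀B ≤ B/2`, the kernel mass `4‖L‖` being `cellMass_le`); iterating,
`w ≡ 0`, and `Π₀u(t)` is invariant under translations along `L`. Elementary real analysis over
the tree's `intervalIntegral`/Bochner API; no new facts. Idea card
`Cruxes/HelicalEndLiouville/Ideas/vanishing-cell-reynolds.md` (Raugel–Sell thin-domain damping;
Gallay–Slijepčević's cell Reynolds number, here generated by the Type-I rate).
-/
noncomputable section

set_option linter.dupNamespace false

open Set MeasureTheory Function Filter
open Literature.Analysis.FluidPDE
open Literature.Analysis.UnboundedOperators (heatExtension)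
open scoped RealInnerProductSpace Topology

namespace Summit.NavierStokesRegularity.NavierStokesRegularity.Theorems

local notation "E3" => EuclideanSpace ℝ (Fin 3)

/-- `∫₀^T σ^{-1/2} dσ = 2 √T`-type bound: `∫_a^b σ^{-1/2} ≤ 2 √b` for `0 ≤ a ≤ b`. [folklore] -/
theorem cellMass_integral_rpow_neg_half_le {a b : ℝ} (ha : 0 ≤ a) (hab : a ≤ b) :
    ∫ σ in a..b, σ ^ (-(1 / 2 : ℝ)) ≤ 2 * Real.sqrt b := by
  rw [show ∫ σ in a..b, σ ^ (-(1 / 2 : ℝ)) = (b ^ (-(1 / 2 : ℝ) + 1) - a ^ (-(1 / 2 : ℝ) + 1)) /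
      (-(1 / 2 : ℝ) + 1) from integral_rpow (Or.inl (by norm_num))]
  have e : (-(1 / 2 : ℝ) + 1) = 1 / 2 := by norm_num
  rw [e, Real.sqrt_eq_rpow]
  have hb : 0 ≤ b := ha.trans hab
  have h1 : 0 ≤ a ^ (1 / 2 : ℝ) := Real.rpow_nonneg ha _
  have h2 : 0 ≤ b ^ (1 / 2 : ℝ) := Real.rpow_nonneg hb _
  rw [div_le_iff₀ (by norm_num : (0:ℝ) < 1 / 2)]
  nlinarith

/-- `∫_{ℓ²}^{b} ℓ² σ^{-3/2} dσ ≤ 2ℓ` for `0 < ℓ`, `ℓ² ≤ b`. [folklore] -/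
theorem cellMass_integral_rpow_neg_three_halves_le {ℓ b : ℝ} (hℓ : 0 < ℓ) (hb : ℓ ^ 2 ≤ b) :
    ∫ σ in (ℓ ^ 2)..b, ℓ ^ 2 * σ ^ (-(3 / 2 : ℝ)) ≤ 2 * ℓ := by
  have hℓ2 : 0 < ℓ ^ 2 := by positivity
  have h0 : (0:ℝ) ∉ Set.uIcc (ℓ ^ 2) b := by
    rw [Set.uIcc_of_le hb]
    intro h
    exact absurd h.1 (not_le.2 hℓ2)
  have h : ∫ σ in (ℓ ^ 2)..b, σ ^ (-(3 / 2 : ℝ)) =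
      (b ^ (-(3 / 2 : ℝ) + 1) - (ℓ ^ 2) ^ (-(3 / 2 : ℝ) + 1)) / (-(3 / 2 : ℝ) + 1) :=
    integral_rpow (Or.inr ⟨by norm_num, h0⟩)
  rw [intervalIntegral.integral_const_mul, h]
  have e : (-(3 / 2 : ℝ) + 1) = -(1 / 2) := by norm_num
  rw [e]
  have hl : (ℓ ^ 2) ^ (-(1 / 2 : ℝ)) = ℓ⁻¹ := by
    rw [show (ℓ ^ 2 : ℝ) = ℓ ^ (2:ℝ) by norm_cast, ← Real.rpow_mul hℓ.le]
    norm_num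
    rw [Real.rpow_neg_one]
  rw [hl]
  have hbpos : 0 < b := hℓ2.trans_le hb
  have hbnn : 0 ≤ b ^ (-(1 / 2 : ℝ)) := Real.rpow_nonneg hbpos.le _
  have : ℓ ^ 2 * ((b ^ (-(1 / 2 : ℝ)) - ℓ⁻¹) / -(1 / 2)) = 2 * ℓ - 2 * ℓ ^ 2 * b ^ (-(1 / 2 : ℝ)) := by
    field_simp
    ring
  rw [this]
  nlinarith [mul_nonneg (sq_nonneg ℓ) hbnn]

/-- **The kernel mass of the gapped Oseen slice**: for `0 < ℓ` and `0 ≤ T`,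
`∫₀^T min(σ^{-1/2}, ℓ² σ^{-3/2}) dσ ≤ 4ℓ` (split at `σ = ℓ²`). [folklore] -/
theorem cellMass_le {ℓ T : ℝ} (hℓ : 0 < ℓ) (hT : 0 ≤ T) :
    ∫ σ in (0:ℝ)..T, min (σ ^ (-(1 / 2 : ℝ))) (ℓ ^ 2 * σ ^ (-(3 / 2 : ℝ))) ≤ 4 * ℓ := by
  -- integrability of the two branches and of the min
  have hI1 : ∀ a b : ℝ, IntervalIntegrable (fun σ : ℝ => σ ^ (-(1 / 2 : ℝ))) volume a b :=
    fun a b => intervalIntegral.intervalIntegrable_rpow' (by norm_num)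
  have hmeas : Measurable fun σ : ℝ => min (σ ^ (-(1 / 2 : ℝ))) (ℓ ^ 2 * σ ^ (-(3 / 2 : ℝ))) :=
    (measurable_id.pow_const _).min ((measurable_id.pow_const _).const_mul _)
  have hmin_nn : ∀ σ : ℝ, 0 ≤ σ → 0 ≤ min (σ ^ (-(1 / 2 : ℝ))) (ℓ ^ 2 * σ ^ (-(3 / 2 : ℝ))) :=
    fun σ hσ => le_min (Real.rpow_nonneg hσ _) (mul_nonneg (sq_nonneg _) (Real.rpow_nonneg hσ _))
  have hImin : ∀ a b : ℝ, 0 ≤ a → a ≤ b →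
      IntervalIntegrable (fun σ : ℝ => min (σ ^ (-(1 / 2 : ℝ))) (ℓ ^ 2 * σ ^ (-(3 / 2 : ℝ))))
        volume a b := by
    intro a b ha hab
    refine (hI1 a b).mono_fun' hmeas.aestronglyMeasurable ?_
    rw [Filter.EventuallyLE, ae_restrict_iff' measurableSet_uIoc]
    refine Eventually.of_forall fun σ hσ => ?_
    rw [Set.uIoc_of_le hab] at hσ
    have hσ0 : 0 ≤ σ := ha.trans hσ.1.le
    rw [Real.norm_eq_abs, abs_of_nonneg (hmin_nn σ hσ0)]
    exact min_le_left _ _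
  rcases le_or_gt T (ℓ ^ 2) with hTl | hTl
  · -- short window: `min ≤ σ^{-1/2}`, `∫₀^T σ^{-1/2} = 2√T ≤ 2ℓ`
    calc ∫ σ in (0:ℝ)..T, min (σ ^ (-(1 / 2 : ℝ))) (ℓ ^ 2 * σ ^ (-(3 / 2 : ℝ)))
        ≤ ∫ σ in (0:ℝ)..T, σ ^ (-(1 / 2 : ℝ)) :=
          intervalIntegral.integral_mono_on hT (hImin 0 T le_rfl hT) (hI1 0 T)
            fun σ _ => min_le_left _ _
      _ ≤ 2 * Real.sqrt T := cellMass_integral_rpow_neg_half_le le_rfl hT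
      _ ≤ 2 * Real.sqrt (ℓ ^ 2) := by gcongr
      _ = 2 * ℓ := by rw [Real.sqrt_sq hℓ.le]
      _ ≤ 4 * ℓ := by linarith
  · -- long window: split at `ℓ²`
    have hl2 : 0 ≤ ℓ ^ 2 := sq_nonneg _
    rw [← intervalIntegral.integral_add_adjacent_intervals (hImin 0 (ℓ ^ 2) le_rfl hl2)
      (hImin (ℓ ^ 2) T hl2 hTl.le)]
    have hA : ∫ σ in (0:ℝ)..ℓ ^ 2, min (σ ^ (-(1 / 2 : ℝ))) (ℓ ^ 2 * σ ^ (-(3 / 2 : ℝ))) ≤ 2 * ℓ :=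
      calc ∫ σ in (0:ℝ)..ℓ ^ 2, min (σ ^ (-(1 / 2 : ℝ))) (ℓ ^ 2 * σ ^ (-(3 / 2 : ℝ)))
          ≤ ∫ σ in (0:ℝ)..ℓ ^ 2, σ ^ (-(1 / 2 : ℝ)) :=
            intervalIntegral.integral_mono_on hl2 (hImin 0 _ le_rfl hl2) (hI1 0 _)
              fun σ _ => min_le_left _ _
        _ ≤ 2 * Real.sqrt (ℓ ^ 2) := cellMass_integral_rpow_neg_half_le le_rfl hl2
        _ = 2 * ℓ := by rw [Real.sqrt_sq hℓ.le]
    have hI3 : IntervalIntegrable (fun σ : ℝ => ℓ ^ 2 * σ ^ (-(3 / 2 : ℝ))) volume (ℓ ^ 2) T := by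
      refine (intervalIntegral.intervalIntegrable_rpow (r := -(3 / 2 : ℝ)) (Or.inr ?_)).const_mul _
      rw [Set.uIcc_of_le hTl.le]
      intro h
      exact absurd h.1 (not_le.2 (by positivity))
    have hB : ∫ σ in ℓ ^ 2..T, min (σ ^ (-(1 / 2 : ℝ))) (ℓ ^ 2 * σ ^ (-(3 / 2 : ℝ))) ≤ 2 * ℓ :=
      calc ∫ σ in ℓ ^ 2..T, min (σ ^ (-(1 / 2 : ℝ))) (ℓ ^ 2 * σ ^ (-(3 / 2 : ℝ)))
          ≤ ∫ σ in ℓ ^ 2..T, ℓ ^ 2 * σ ^ (-(3 / 2 : ℝ)) :=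
            intervalIntegral.integral_mono_on hTl.le (hImin _ _ hl2 hTl.le) hI3
              fun σ _ => min_le_right _ _
        _ ≤ 2 * ℓ := cellMass_integral_rpow_neg_three_halves_le hℓ hTl.le
    linarith


/-- The cell mean `Π₀ f (x) = ∫₀¹ f (x + rL) dr` of an `L`-periodic field is invariant under
every translation along `L`: `Π₀ f (x + sL) = Π₀ f (x)` (the integrand is `1`-periodic in `r`;
same statement as `cellOscSlice_mean_transl` of the sibling stub file, repeated here to keep this
file independent of it). [folklore] -/
theorem cellAbs_mean_transl {f : E3 → E3} {L : E3} (hper : ∀ x, f (x + L) = f x)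
    (x : E3) (s : ℝ) :
    ∫ r in (0:ℝ)..1, f (x + s • L + r • L) = ∫ r in (0:ℝ)..1, f (x + r • L) := by
  have hφ : Periodic (fun r : ℝ => f (x + r • L)) 1 := fun r => by
    simp only [add_smul, one_smul, ← add_assoc]
    exact hper _
  calc ∫ r in (0:ℝ)..1, f (x + s • L + r • L)
      = ∫ r in (0:ℝ)..1, (fun r' : ℝ => f (x + r' • L)) (r + s) := by
        refine intervalIntegral.integral_congr fun r _ => ?_
        simp only [add_smul]
        congr 1
        abel
    _ = ∫ r in (0:ℝ) + s..1 + s, (fun r' : ℝ => f (x + r' • L)) r :=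
        intervalIntegral.integral_comp_add_right (fun r' : ℝ => f (x + r' • L)) s
    _ = ∫ r in s..s + 1, (fun r' : ℝ => f (x + r' • L)) r := by rw [zero_add, add_comm]
    _ = ∫ r in (0:ℝ)..0 + 1, (fun r' : ℝ => f (x + r' • L)) r := hφ.intervalIntegral_add_eq s 0
    _ = ∫ r in (0:ℝ)..1, f (x + r • L) := by rw [zero_add]

/-- **The free term dies as `s → −∞`**: if `a ≤ k /((τ₁ − s)√(−s)) + b` for every `s < τ₁`,
`s < 0`, with `k ≥ 0`, then `a ≤ b`. [folklore] -/
theorem cellAbs_le_of_forall_free {a b k τ₁ : ℝ} (hk : 0 ≤ k)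
    (h : ∀ s : ℝ, s < τ₁ → s < 0 → a ≤ k / ((τ₁ - s) * Real.sqrt (-s)) + b) : a ≤ b := by
  refine le_of_forall_pos_lt_add fun ε hε => ?_
  set Q : ℝ := k / ε + 1 with hQ
  have hQpos : 0 < Q := by positivity
  set s : ℝ := min (τ₁ - 1) (-(Q ^ 2)) with hs
  have hs1 : s ≤ τ₁ - 1 := min_le_left _ _
  have hs2 : s ≤ -(Q ^ 2) := min_le_right _ _
  have hQ2 : 0 < Q ^ 2 := by positivity
  have hs0 : s < 0 := by linarith
  have hsqrt : Q ≤ Real.sqrt (-s) := by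
    rw [show Q = Real.sqrt (Q ^ 2) from (Real.sqrt_sq hQpos.le).symm]
    exact Real.sqrt_le_sqrt (by linarith)
  have hden : Q ≤ (τ₁ - s) * Real.sqrt (-s) := by
    calc Q = 1 * Q := (one_mul Q).symm
      _ ≤ (τ₁ - s) * Real.sqrt (-s) :=
          mul_le_mul (by linarith) hsqrt hQpos.le (by linarith)
  have h1 : k / ((τ₁ - s) * Real.sqrt (-s)) ≤ k / Q :=
    div_le_div_of_nonneg_left hk hQpos hden
  have h2 : k / Q < ε := by
    rw [div_lt_iff₀ hQpos, hQ, mul_add, mul_one, mul_div_cancel₀ _ hε.ne']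
    linarith
  have := h s (by linarith) hs0
  linarith

/-- **Extinction from indefinite halving**: a quantity bounded by `B₀/2ⁿ` for every `n` is `≤ 0`. [folklore] -/
theorem cellAbs_le_zero_of_forall_pow {a B₀ : ℝ} (h : ∀ n : ℕ, a ≤ B₀ / 2 ^ n) : a ≤ 0 := by
  have hlim : Tendsto (fun n : ℕ => B₀ / 2 ^ n) atTop (𝓝 0) := by
    have h1 := (tendsto_pow_atTop_nhds_zero_of_lt_one (by norm_num : (0 : ℝ) ≤ 1 / 2)
      (by norm_num : (1 / 2 : ℝ) < 1)).const_mul B₀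
    rw [mul_zero] at h1
    refine h1.congr fun n => ?_
    rw [one_div, inv_pow, div_eq_mul_inv]
  exact ge_of_tendsto' hlim h

/-- **Stub 5 of the line `vanishing-cell-reynolds` (far-past cell extinction by absorption)**:
given the heat cell gap (`κ`), the representation of the cell oscillation (`stub_cellOscRepr`) and
the linear slice bound (`stub_cellOscSlice`, `K`), an `L`-periodic (`L ≠ 0`) element of `A_C` on an
end `t < θ ≤ 0` is invariant under ALL translations along `L` at every `t < θ`,
`t < −(8KC‖L‖)²` (proof in the module docstring; signature = the registered stub). [folklore] -/
theorem stub_cellAbsorption :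
    ∀ κ K : ℝ,
      (∀ (L : E3) (g : E3 → E3) (M σ : ℝ), Continuous g → (∀ x, g (x + L) = g x) →
        (∀ x, ‖g x‖ ≤ M) → 0 < σ → ∀ x : E3,
          ‖heatExtension g σ x - ∫ r in (0:ℝ)..1, heatExtension g σ (x + r • L)‖ ≤
            κ * (‖L‖ ^ 2 / σ) * M) →
      (∀ (C : ℝ) (u : ℝ → E3 → E3), IsTypeIAncientMild C u → ∀ (L : E3) (s t : ℝ), s < t → t < 0 →
        ∀ x : E3,
          u t x - (∫ r in (0:ℝ)..1, u t (x + r • L)) =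
            (heatExtension (u s) (t - s) x -
              ∫ r in (0:ℝ)..1, heatExtension (u s) (t - s) (x + r • L)) -
            ∫ τ in Set.Ioo s t, (oseenSlice (t - τ) (u τ) (u τ) x -
              ∫ r in (0:ℝ)..1, oseenSlice (t - τ) (u τ) (u τ) (x + r • L))) →
      (∀ (L : E3) (f : E3 → E3) (M S σ : ℝ), Continuous f →
        (∀ x, f (x + L) = f x) → (∀ x, ‖f x‖ ≤ M) →
        (∀ x, ‖f x - ∫ r in (0:ℝ)..1, f (x + r • L)‖ ≤ S) → 0 < σ → ∀ x : E3,
          ‖oseenSlice σ f f x - ∫ r in (0:ℝ)..1, oseenSlice σ f f (x + r • L)‖ ≤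
            K * min (σ ^ (-(1 / 2 : ℝ))) (‖L‖ ^ 2 * σ ^ (-(3 / 2 : ℝ))) * M * S) →
      ∀ (C : ℝ) (u : ℝ → E3 → E3), IsTypeIAncientMild C u → ∀ (L : E3) (θ : ℝ), L ≠ 0 → θ ≤ 0 →
        (∀ t < θ, ∀ x, u t (x + L) = u t x) →
        ∀ t < θ, t < -(8 * K * C * ‖L‖) ^ 2 → ∀ (x : E3) (s : ℝ), u t (x + s • L) = u t x := by
  intro κ K hheat hrepr hslice C u hu L θ hL0 hθ hper t ht htK x s
  have hC : 0 ≤ C := hu.nonneg; have ht0 : t < 0 := lt_of_lt_of_le ht hθ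
  have hLpos : 0 < ‖L‖ := norm_pos_iff.2 hL0
  have hst : 0 < Real.sqrt (-t) := Real.sqrt_pos.2 (by linarith)
  -- the nonnegative slice constant `K' = max K 0`
  set K' : ℝ := max K 0 with hK'
  have hK'0 : 0 ≤ K' := le_max_right _ _
  have hKK' : K ≤ K' := le_max_left _ _
  have hslice' : ∀ (f : E3 → E3) (M S σ : ℝ), Continuous f →
      (∀ x, f (x + L) = f x) → (∀ x, ‖f x‖ ≤ M) →
      (∀ x, ‖f x - ∫ r in (0:ℝ)..1, f (x + r • L)‖ ≤ S) → 0 < σ → ∀ x : E3,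
        ‖oseenSlice σ f f x - ∫ r in (0:ℝ)..1, oseenSlice σ f f (x + r • L)‖ ≤
          (K' * M * S) * min (σ ^ (-(1 / 2 : ℝ))) (‖L‖ ^ 2 * σ ^ (-(3 / 2 : ℝ))) := by
    intro f M S σ hf hfper hfM hfS hσ y
    have hM : 0 ≤ M := (norm_nonneg _).trans (hfM 0)
    have hS : 0 ≤ S := (norm_nonneg _).trans (hfS 0)
    have hmin : 0 ≤ min (σ ^ (-(1 / 2 : ℝ))) (‖L‖ ^ 2 * σ ^ (-(3 / 2 : ℝ))) :=
      le_min (Real.rpow_nonneg hσ.le _) (mul_nonneg (sq_nonneg _) (Real.rpow_nonneg hσ.le _))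
    refine (hslice L f M S σ hf hfper hfM hfS hσ y).trans ?_
    have : K * min (σ ^ (-(1 / 2 : ℝ))) (‖L‖ ^ 2 * σ ^ (-(3 / 2 : ℝ))) * M * S ≤
        K' * min (σ ^ (-(1 / 2 : ℝ))) (‖L‖ ^ 2 * σ ^ (-(3 / 2 : ℝ))) * M * S := by
      gcongr
    refine this.trans (le_of_eq ?_)
    ring
  -- the threshold: `8 K' C ‖L‖ ≤ √(−t)`
  have h8 : 8 * K' * C * ‖L‖ ≤ Real.sqrt (-t) := by
    have hnn : 0 ≤ 8 * K' * C * ‖L‖ := by positivity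
    have habs : 8 * K' * C * ‖L‖ ≤ |8 * K * C * ‖L‖| := by
      rw [abs_mul, abs_mul, abs_mul, abs_of_nonneg hC, abs_of_nonneg (norm_nonneg L),
        abs_of_nonneg (by norm_num : (0:ℝ) ≤ 8)]
      gcongr
      exact max_le (le_abs_self K) (abs_nonneg K)
    have hsq : (8 * K' * C * ‖L‖) ^ 2 ≤ (8 * K * C * ‖L‖) ^ 2 := by
      calc (8 * K' * C * ‖L‖) ^ 2 ≤ |8 * K * C * ‖L‖| ^ 2 := by gcongr
        _ = (8 * K * C * ‖L‖) ^ 2 := sq_abs _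
    refine Real.le_sqrt_of_sq_le ?_
    linarith
  -- uniform bounds on the end `τ ≤ t`
  set M₀ : ℝ := C / Real.sqrt (-t) with hM₀
  have hM₀nn : 0 ≤ M₀ := div_nonneg hC hst.le
  have hslab : ∀ τ ≤ t, ∀ y, ‖u τ y‖ ≤ M₀ := by
    intro τ hτ y
    have hτ0 : τ < 0 := lt_of_le_of_lt hτ ht0
    refine (hu.norm_le hτ0 y).trans ?_
    exact div_le_div_of_nonneg_left hC hst (Real.sqrt_le_sqrt (by linarith))
  have hcoef : 4 * K' * ‖L‖ * M₀ ≤ 1 / 2 := by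
    rw [hM₀]
    rw [show 4 * K' * ‖L‖ * (C / Real.sqrt (-t)) = (8 * K' * C * ‖L‖) / Real.sqrt (-t) / 2 by
      field_simp; ring]
    have : (8 * K' * C * ‖L‖) / Real.sqrt (-t) ≤ 1 := div_le_one_of_le₀ h8 hst.le
    linarith
  -- the oscillation `w τ y = u τ y − Π₀ (u τ) y` is bounded by `2 M₀` on the end
  have hw0 : ∀ τ ≤ t, ∀ y, ‖u τ y - ∫ r in (0:ℝ)..1, u τ (y + r • L)‖ ≤ 2 * M₀ := by
    intro τ hτ y
    have h1 := hslab τ hτ y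
    have h2 : ‖∫ r in (0:ℝ)..1, u τ (y + r • L)‖ ≤ M₀ := by
      have h := intervalIntegral.norm_integral_le_of_norm_le_const (a := (0:ℝ)) (b := 1)
        (f := fun r : ℝ => u τ (y + r • L)) (C := M₀) fun r _ => hslab τ hτ _
      simpa using h
    calc ‖u τ y - ∫ r in (0:ℝ)..1, u τ (y + r • L)‖
        ≤ ‖u τ y‖ + ‖∫ r in (0:ℝ)..1, u τ (y + r • L)‖ := norm_sub_le _ _
      _ ≤ M₀ + M₀ := add_le_add h1 h2
      _ = 2 * M₀ := by ring
  -- KEY STEP: any uniform bound `B` of the oscillation on the end improves to `B/2`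
  have hhalf : ∀ B : ℝ, 0 ≤ B → (∀ τ ≤ t, ∀ y, ‖u τ y - ∫ r in (0:ℝ)..1, u τ (y + r • L)‖ ≤ B) →
      ∀ τ ≤ t, ∀ y, ‖u τ y - ∫ r in (0:ℝ)..1, u τ (y + r • L)‖ ≤ B / 2 := by
    intro B hB hwB τ₁ hτ₁ y
    have hτ₁0 : τ₁ < 0 := lt_of_le_of_lt hτ₁ ht0
    have hτ₁θ : τ₁ < θ := lt_of_le_of_lt hτ₁ ht
    -- the estimate for every initial time `s' < τ₁`
    have hest : ∀ s' : ℝ, s' < τ₁ → s' < 0 →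
        ‖u τ₁ y - ∫ r in (0:ℝ)..1, u τ₁ (y + r • L)‖ ≤
          |κ| * ‖L‖ ^ 2 * C / ((τ₁ - s') * Real.sqrt (-s')) + 4 * K' * ‖L‖ * M₀ * B := by
      intro s' hs' hs'0
      have hs'θ : s' < θ := hs'.trans hτ₁θ
      have hσpos : 0 < τ₁ - s' := sub_pos.2 hs'
      have hss : 0 < Real.sqrt (-s') := Real.sqrt_pos.2 (by linarith)
      -- the representation
      have hid := hrepr C u hu L s' τ₁ hs' hτ₁0 y
      -- the free term
      have hfree : ‖heatExtension (u s') (τ₁ - s') y -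
          ∫ r in (0:ℝ)..1, heatExtension (u s') (τ₁ - s') (y + r • L)‖ ≤
            |κ| * ‖L‖ ^ 2 * C / ((τ₁ - s') * Real.sqrt (-s')) := by
        have h := hheat L (u s') (C / Real.sqrt (-s')) (τ₁ - s') (hu.continuous_slice hs'0)
          (hper s' hs'θ) (fun z => hu.norm_le hs'0 z) hσpos y
        refine h.trans ?_
        have hnn : 0 ≤ ‖L‖ ^ 2 / (τ₁ - s') * (C / Real.sqrt (-s')) := by positivity
        calc κ * (‖L‖ ^ 2 / (τ₁ - s')) * (C / Real.sqrt (-s'))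
            = κ * (‖L‖ ^ 2 / (τ₁ - s') * (C / Real.sqrt (-s'))) := by ring
          _ ≤ |κ| * (‖L‖ ^ 2 / (τ₁ - s') * (C / Real.sqrt (-s'))) :=
              mul_le_mul_of_nonneg_right (le_abs_self κ) hnn
          _ = |κ| * ‖L‖ ^ 2 * C / ((τ₁ - s') * Real.sqrt (-s')) := by
              field_simp
      -- the Duhamel term: pointwise bound of the oscillating slices
      set m : ℝ → ℝ := fun σ =>
        min ((τ₁ - σ) ^ (-(1 / 2 : ℝ))) (‖L‖ ^ 2 * (τ₁ - σ) ^ (-(3 / 2 : ℝ))) with hm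
      have hpt : ∀ σ ∈ Ioo s' τ₁,
          ‖oseenSlice (τ₁ - σ) (u σ) (u σ) y -
              ∫ r in (0:ℝ)..1, oseenSlice (τ₁ - σ) (u σ) (u σ) (y + r • L)‖ ≤
            (K' * M₀ * B) * m σ := by
        intro σ hσ
        have hσ0 : σ < 0 := hσ.2.trans hτ₁0
        have hσθ : σ < θ := hσ.2.trans hτ₁θ
        have hσt : σ ≤ t := hσ.2.le.trans hτ₁
        exact hslice' (u σ) M₀ B (τ₁ - σ) (hu.continuous_slice hσ0) (hper σ hσθ)
          (hslab σ hσt) (hwB σ hσt) (sub_pos.2 hσ.2) y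
      -- integrability of the majorant on `(s', τ₁)`
      have hm_meas : Measurable m :=
        ((measurable_const.sub measurable_id).pow_const _).min
          (((measurable_const.sub measurable_id).pow_const _).const_mul _)
      have hm_int : IntegrableOn m (Ioo s' τ₁) := by
        have h1 : IntegrableOn (fun σ : ℝ => (τ₁ - σ) ^ (-(1 / 2 : ℝ))) (Ioo s' τ₁) := by
          have h := (intervalIntegral.intervalIntegrable_rpow' (a := τ₁ - s') (b := 0)
            (show (-1 : ℝ) < -(1 / 2) by norm_num)).comp_sub_left τ₁
          rw [sub_sub_cancel, sub_zero] at h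
          exact h.1.mono_set Ioo_subset_Ioc_self
        refine h1.mono' hm_meas.aestronglyMeasurable ?_
        refine ae_restrict_of_forall_mem measurableSet_Ioo fun σ hσ => ?_
        have hpos : 0 < τ₁ - σ := sub_pos.2 hσ.2
        rw [Real.norm_eq_abs, abs_of_nonneg (le_min (Real.rpow_nonneg hpos.le _)
          (mul_nonneg (sq_nonneg _) (Real.rpow_nonneg hpos.le _)))]
        exact min_le_left _ _
      -- the kernel mass on `(s', τ₁)` is at most `4‖L‖`
      have hmass : ∫ σ in Ioo s' τ₁, m σ ≤ 4 * ‖L‖ := by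
        rw [← integral_Ioc_eq_integral_Ioo, ← intervalIntegral.integral_of_le hs'.le]
        have hsub : ∫ σ in s'..τ₁, m σ =
            ∫ σ in (0:ℝ)..τ₁ - s', min (σ ^ (-(1 / 2 : ℝ))) (‖L‖ ^ 2 * σ ^ (-(3 / 2 : ℝ))) := by
          rw [hm]
          have h := intervalIntegral.integral_comp_sub_left
            (fun σ : ℝ => min (σ ^ (-(1 / 2 : ℝ))) (‖L‖ ^ 2 * σ ^ (-(3 / 2 : ℝ)))) τ₁
            (a := s') (b := τ₁)
          rw [sub_self] at h
          exact h
        rw [hsub]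
        exact cellMass_le hLpos hσpos.le
      -- the Duhamel bound
      have hduh : ‖∫ σ in Ioo s' τ₁, (oseenSlice (τ₁ - σ) (u σ) (u σ) y -
          ∫ r in (0:ℝ)..1, oseenSlice (τ₁ - σ) (u σ) (u σ) (y + r • L))‖ ≤
            4 * K' * ‖L‖ * M₀ * B := by
        have hKMB : 0 ≤ K' * M₀ * B := by positivity
        calc ‖∫ σ in Ioo s' τ₁, (oseenSlice (τ₁ - σ) (u σ) (u σ) y -
              ∫ r in (0:ℝ)..1, oseenSlice (τ₁ - σ) (u σ) (u σ) (y + r • L))‖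
            ≤ ∫ σ in Ioo s' τ₁, (K' * M₀ * B) * m σ :=
              norm_integral_le_of_norm_le (hm_int.const_mul _)
                (ae_restrict_of_forall_mem measurableSet_Ioo hpt)
          _ = (K' * M₀ * B) * ∫ σ in Ioo s' τ₁, m σ := integral_const_mul _ _
          _ ≤ (K' * M₀ * B) * (4 * ‖L‖) := mul_le_mul_of_nonneg_left hmass hKMB
          _ = 4 * K' * ‖L‖ * M₀ * B := by ring
      -- assemble
      rw [hid]
      exact (norm_sub_le _ _).trans (add_le_add hfree hduh)
    -- let `s' → −∞`, then use the threshold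
    have hlim : ‖u τ₁ y - ∫ r in (0:ℝ)..1, u τ₁ (y + r • L)‖ ≤ 4 * K' * ‖L‖ * M₀ * B :=
      cellAbs_le_of_forall_free (by positivity) hest
    calc ‖u τ₁ y - ∫ r in (0:ℝ)..1, u τ₁ (y + r • L)‖ ≤ 4 * K' * ‖L‖ * M₀ * B := hlim
      _ ≤ 1 / 2 * B := mul_le_mul_of_nonneg_right hcoef hB
      _ = B / 2 := by ring
  -- iterate: the oscillation is `≤ 2M₀/2ⁿ` for every `n`, hence zero, on the end
  have hiter : ∀ n : ℕ, ∀ τ ≤ t, ∀ y,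
      ‖u τ y - ∫ r in (0:ℝ)..1, u τ (y + r • L)‖ ≤ 2 * M₀ / 2 ^ n := by
    intro n
    induction n with
    | zero => intro τ hτ y; simpa using hw0 τ hτ y
    | succ n ih =>
      intro τ hτ y
      have h := hhalf (2 * M₀ / 2 ^ n) (by positivity) ih τ hτ y
      rw [pow_succ, ← div_div]
      exact h
  have hwzero : ∀ y, u t y = ∫ r in (0:ℝ)..1, u t (y + r • L) := by
    intro y
    have h : ‖u t y - ∫ r in (0:ℝ)..1, u t (y + r • L)‖ ≤ 0 :=
      cellAbs_le_zero_of_forall_pow fun n => hiter n t le_rfl y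
    exact sub_eq_zero.1 (norm_le_zero_iff.1 h)
  -- conclude: `u(t) = Π₀ u(t)` is invariant under translations along `L`
  rw [hwzero (x + s • L), hwzero x]
  exact cellAbs_mean_transl (hper t ht) x s

end Summit.NavierStokesRegularity.NavierStokesRegularity.Theorems

end
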